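import Mathlib
import Summits.Ventures.PercRepro.TriangleCapBelowCapGen
import Summits.Ventures.PercRepro.TriangleCapFiveRowFourCap

/-!
# PercRepro — THE CAP ON THE CELLS `(k, a, a − 2)` AND `(k, a, a − 1)` FOR EVERY ROW `a ≥ 5`: a `K₄⁻`-free graph with
`a (k − a) − r` edges, `r ∈ {a − 2, a − 1}`, `k ≥ a + 2r + 2`, with a vertex of degree `k − a`, is `a`-bipartite or at
least `2 (k − 2a − 1)` below the closed form — the one-triangle structure at a general `a` (p3, gen 47; part 200f)

The count of part 196a at the cap: `2 (a − 1) K − 2r = 2M + 2P + E` (`K = k − a`, `M` the matching inside `N = N(x)`,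
`R` the `a − 1` non-neighbours, `P = Σ_R degIn N`, `E = adjPairs R`); an edge inside `R` is impossible for
`K ≥ 2r + 2` (`below_cap_noedge`), so `E = 0`, and then `(a − 2) M ≤ r ≤ a − 1` gives `M ≤ 1`. `M = 0` is
`D ⊆ K(N(x)ᶜ, N(x))`. `M = 1` (one edge `y₁ y₂` inside `N`): `P = (a − 1) K − r − 1`, every `u ∈ R` sees at most
`K − 1` vertices of `N` (one end of `y₁ y₂`), so the deficit `δ = (a − 1)(K − 1) − P = r + 2 − a ∈ {0, 1}` is carried
by at most one vertex: `Σ_R d² + (2K − 3) δ ≤ (a − 1)(K − 1)²` (`capT_R_sum`); on `N`,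
`d(y) = 1 + f(y) + g(y)` with `f ≤ 1`, `g ≤ a − 1` and `(1 + f + g)² ≤ 1 + 3f + (a + 1) g + 2fg`
(`cap_sq_bound_gen`), `Σ f = 2`, `Σ g = P`, `2 Σ fg ≤ (a − 1) · 2`; the arithmetic `capT_sq_arith` closes with slack
`0` at `r = a − 2` (the one-triangle family `tFamilyGen (k − 1) a 0` is a cap graph exactly `2 (k − 2a − 1)` below)
and slack `a − 4` at `r = a − 1`. Axioms: standard.
-/

namespace PercRepro

namespace TriangleCap

namespace C047

open Finset

variable {V : Type*} [Fintype V] [DecidableEq V]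

/-- `(1 + f + g)² ≤ 1 + 3f + (a + 1) g + 2fg` for `f ≤ 1`, `g + 1 ≤ a`. -/
theorem cap_sq_bound_gen (f g a : ℕ) (hf : f ≤ 1) (hg : g + 1 ≤ a) :
    (1 + f + g) * (1 + f + g) ≤ 1 + 3 * f + (a + 1) * g + 2 * (f * g) := by
  have hf2 : f * f ≤ f := by interval_cases f <;> norm_num
  have hg2 : g * g ≤ (a - 1) * g := Nat.mul_le_mul_right g (by omega)
  have e : (a + 1) * g = (a - 1) * g + 2 * g := by
    have : a + 1 = (a - 1) + 2 := by omega
    rw [this, add_mul]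
  rw [e]
  nlinarith [hf2, hg2]

/-- A vertex of `R` at `P ∈ {K − 2, K − 1}`: `P² + (2K − 3)(K − 1) ≤ (K − 1)² + (2K − 3) P`. -/
theorem capT_R_vertex (P K : ℕ) (hK : 2 ≤ K) (hP1 : P + 1 ≤ K) (hP2 : K ≤ P + 2) :
    P * P + (2 * K - 3) * (K - 1) ≤ (K - 1) * (K - 1) + (2 * K - 3) * P := by
  obtain ⟨t, rfl⟩ : ∃ t, K = t + 2 := ⟨K - 2, by omega⟩
  have e1 : 2 * (t + 2) - 3 = 2 * t + 1 := by omega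
  have e2 : t + 2 - 1 = t + 1 := by omega
  rw [e1, e2]
  rcases Nat.lt_or_ge P (t + 1) with h | h
  · have : P = t := by omega
    subst this
    nlinarith
  · have : P = t + 1 := by omega
    subst this
    nlinarith

omit [Fintype V] in
/-- **THE `R`-SUM AT `M = 1`:** if every `u ∈ R` has `degIn N u ≤ K − 1` and `Σ_R degIn N + δ = |R| (K − 1)` with
`δ ≤ 1`, then `Σ_R (degIn N)² + (2K − 3) δ ≤ |R| (K − 1)²` (`K ≥ 2`). -/
theorem capT_R_sum (D : SimpleGraph V) [DecidableRel D.Adj] (R N : Finset V) (K δ : ℕ) (hK : 2 ≤ K)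
    (hPle : ∀ u ∈ R, degIn D N u + 1 ≤ K) (hsum : ∑ u ∈ R, degIn D N u + δ = R.card * (K - 1)) (hδ : δ ≤ 1) :
    ∑ u ∈ R, degIn D N u * degIn D N u + (2 * K - 3) * δ ≤ R.card * ((K - 1) * (K - 1)) := by
  -- every vertex of `R` is at `≥ K − 2`
  have hlow : ∀ u ∈ R, K ≤ degIn D N u + 2 := by
    intro u hu
    have h1 := add_sum_erase R (fun w => degIn D N w) hu
    have h2 : ∑ w ∈ R.erase u, degIn D N w ≤ ∑ _w ∈ R.erase u, (K - 1) :=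
      sum_le_sum (fun w hw => by have := hPle w (mem_of_mem_erase hw); omega)
    rw [sum_const, smul_eq_mul, card_erase_of_mem hu] at h2
    have hR1 : 1 ≤ R.card := card_pos.mpr ⟨u, hu⟩
    have e : R.card * (K - 1) = (R.card - 1) * (K - 1) + (K - 1) := by
      obtain ⟨c, hc⟩ : ∃ c, R.card = c + 1 := ⟨R.card - 1, by omega⟩
      rw [hc, Nat.add_sub_cancel, add_mul, one_mul]
    omega
  have h := sum_le_sum (fun u hu => capT_R_vertex (degIn D N u) K hK (hPle u hu) (hlow u hu))
  rw [sum_add_distrib, sum_add_distrib, sum_const, sum_const, smul_eq_mul, smul_eq_mul, ← mul_sum] at h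
  have e1 : (2 * K - 3) * (∑ u ∈ R, degIn D N u + δ) = (2 * K - 3) * ∑ u ∈ R, degIn D N u + (2 * K - 3) * δ :=
    mul_add _ _ _
  rw [hsum] at e1
  have e2 : R.card * ((2 * K - 3) * (K - 1)) = (2 * K - 3) * (R.card * (K - 1)) := by ring
  rw [e2] at h
  omega

/-- **THE ARITHMETIC OF `M = 1` AT A GENERAL `a`:** `a = r + 2 − δ`... stated as `r + 2 = a + δ`, `δ ≤ 1`, `5 ≤ a`,
`K ≥ 2r + 2`, `m + r = a K`, `P + r + 1 + K = a K`, `S_N ≤ K + 6 + (a + 1) P + 2 (a − 1)`,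
`S_R + (2K − 3) δ ≤ (a − 1)(K − 1)²` ⇒ `K² + S_N + S_R + r (k − 1 − r) + 2 (k − 2a − 1) ≤ m k`, `k = K + a`. -/
theorem capT_sq_arith (a K P SN SR m r δ : ℕ) (ha : 5 ≤ a) (hra : r + 2 = a + δ) (hδ : δ ≤ 1)
    (hK : 2 * r + 2 ≤ K) (hm : m + r = a * K) (hP : P + r + 1 + K = a * K)
    (hSN : SN ≤ K + 6 + (a + 1) * P + 2 * (a - 1)) (hSR : SR + (2 * K - 3) * δ ≤ (a - 1) * ((K - 1) * (K - 1))) :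
    K * K + SN + SR + r * (K + a - 1 - r) + 2 * (K + a - 2 * a - 1) ≤ m * (K + a) := by
  interval_cases δ
  · -- `r = a − 2`: slack `0`
    obtain ⟨q, rfl⟩ : ∃ q, a = q + 5 := ⟨a - 5, by omega⟩
    have hr : r = q + 3 := by omega
    subst hr
    obtain ⟨t, rfl⟩ : ∃ t, K = 2 * (q + 3) + 2 + t := ⟨K - (2 * (q + 3) + 2), by omega⟩
    have e1 : 2 * (q + 3) + 2 + t + (q + 5) - 1 - (q + 3) = 2 * q + t + 9 := by omega
    have e2 : 2 * (q + 3) + 2 + t + (q + 5) - 2 * (q + 5) - 1 = q + t + 2 := by omega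
    have e3 : q + 5 - 1 = q + 4 := by omega
    have e4 : 2 * (q + 3) + 2 + t - 1 = 2 * q + t + 7 := by omega
    have e5 : 2 * (2 * (q + 3) + 2 + t) - 3 = 4 * q + 2 * t + 13 := by omega
    rw [e1, e2]
    rw [e3, e4, e5] at hSR
    rw [e3] at hSN
    have hm' : m = 2 * q * q + 17 * q + q * t + 5 * t + 37 := by ring_nf at hm ⊢; omega
    have hP' : P = 2 * q * q + 15 * q + q * t + 4 * t + 28 := by ring_nf at hP ⊢; omega
    subst hm' hP'
    clear e1 e2 e3 e4 e5 hm hP hK ha hra hδ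
    nlinarith [hSN, hSR]
  · -- `r = a − 1`: slack `a − 4`
    obtain ⟨q, rfl⟩ : ∃ q, a = q + 5 := ⟨a - 5, by omega⟩
    have hr : r = q + 4 := by omega
    subst hr
    obtain ⟨t, rfl⟩ : ∃ t, K = 2 * (q + 4) + 2 + t := ⟨K - (2 * (q + 4) + 2), by omega⟩
    have e1 : 2 * (q + 4) + 2 + t + (q + 5) - 1 - (q + 4) = 2 * q + t + 10 := by omega
    have e2 : 2 * (q + 4) + 2 + t + (q + 5) - 2 * (q + 5) - 1 = q + t + 4 := by omega
    have e3 : q + 5 - 1 = q + 4 := by omega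
    have e4 : 2 * (q + 4) + 2 + t - 1 = 2 * q + t + 9 := by omega
    have e5 : 2 * (2 * (q + 4) + 2 + t) - 3 = 4 * q + 2 * t + 17 := by omega
    rw [e1, e2]
    rw [e3, e4, e5] at hSR
    rw [e3] at hSN
    have hm' : m = 2 * q * q + 19 * q + q * t + 5 * t + 46 := by ring_nf at hm ⊢; omega
    have hP' : P = 2 * q * q + 17 * q + q * t + 4 * t + 35 := by ring_nf at hP ⊢; omega
    subst hm' hP'
    clear e1 e2 e3 e4 e5 hm hP hK ha hra hδ
    nlinarith [hSN, hSR]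

/-- `(a − 2) M ≤ r ≤ a − 1` ⇒ `M ≤ 1` (`a ≥ 4`): the count with `E = 0`. -/
theorem capT_matching (a K M P m r : ℕ) (ha : 4 ≤ a) (hdeg : K + (K + 2 * M + P) + (P + 0) = 2 * m)
    (hm : m + r = a * K) (h2 : P + (a - 1) * M ≤ (a - 1) * K) (hr : r + 1 ≤ a) : M ≤ 1 := by
  by_contra hM
  have hM2 : 2 ≤ M := by omega
  obtain ⟨a', rfl⟩ : ∃ a', a = a' + 4 := ⟨a - 4, by omega⟩
  have e : a' + 4 - 1 = a' + 3 := by omega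
  rw [e] at h2
  have hMM : (a' + 2) * 2 ≤ (a' + 2) * M := Nat.mul_le_mul_left _ hM2
  nlinarith [hdeg, hm, h2, hMM]

end C047

end TriangleCap

end PercRepro
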